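import Literature.MathematicalPhysics.QuantumLattice.HubbardWave0
import HarnessLib

/-!
# Spin-resolved configurations, sectors and Lieb's coefficient matrix for the Hubbard model

Family `hubbard` (trunk T-QLATTICE). Vocabulary for the proof of Lieb's Theorem 1 on the
attractive Hubbard model (`Literature.MathematicalPhysics.QuantumLattice.lieb_attractive` in `HubbardWave0`; the proof is in
`HubbardWave0LiebProofs`), on top of the wave-0 glue (`Fock`, `Orb Λ = Λ ×ₗ Fin 2`, `orb`,
`jwSign`, `creation`, `annihilation`, `hamiltonian`, all reused).

Lieb (PRL 62 (1989) 1201, proof of Theorem 1) works in the `S^z = 0` sector with `n = N/2`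
electrons of each spin and expands a state as `ψ = Σ_{α,β} W_{αβ} ψ^α_↑ ⊗ ψ^β_↓` over the
real occupation bases `ψ^α = ∏_{x ∈ α} c†_x |0⟩` of `n` spinless fermions; the Hamiltonian then
acts on the `m × m` matrix `W` (`m = (|Λ| choose n)`) as `W ↦ KW + WK + Σ_x U_x L_x W L_x`
(eq. (4)), with `K` the spinless hopping matrix and `L_x` the diagonal occupation matrix of the
site `x`. This file provides exactly this bookkeeping for the concrete Jordan–Wigner model of
`HubbardWave0`:

* `upPart s`, `downPart s`, `pairSet α β` (the configuration `α↑ ∪ β↓`) and the equivalence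
  `configEquiv : Finset (Orb Λ) ≃ Finset Λ × Finset Λ`; the Jordan–Wigner signs of spin orbitals
  in terms of site data (`jwSign_orb_zero`, `jwSign_orb_one`, `leSign`, `gtSign`) and Lieb's
  sign `pairSign α β = ∏_{a ∈ α} jwSign a β` relating `|α↑ ∪ β↓⟩` to `ψ^α_↑ ⊗ ψ^β_↓`;
* spin sectors: `IsInSector a b ψ`, the restriction `sectorProj a b ψ`, and the entrywise
  predicates `PreservesSectors M`, `RaisesSpin M`, `LowersSpin M` on operators;
* `Config Λ n = {α : Finset Λ // #α = n}`, the spinless hopping matrix `hoppingMatrix G t`,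
  Lieb's matrices `liebK G t n` (`K`) and `liebL n x` (`L_x`), the restricted hopping term
  `configHop n x y`, hopping moves `IsHop G α β` of configurations and their connectivity on a
  connected graph (`reflTransGen_isHop`, Lieb: "since `Λ` is connected, the `α`'s are connected
  by `K`");
* Lieb's coefficient matrix `liebW n ψ` (`W_{αβ} = pairSign α β · ψ (pairSet α β)`) and its
  inverse `liebVec n W` on the `(n, n)` sector.

All definitions are concrete (no `sorry`, no `opaque`); the API lemmas here use only the
definitions of `HubbardWave0` (the CAR-level facts are in `HubbardWave0CARProofs` and
`HubbardWave0LiebProofs`).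

## References

* E. H. Lieb, *Two theorems on the Hubbard model*, Phys. Rev. Lett. 62 (1989) 1201–1204,
  Theorem 1 and its proof, eqs. (1)–(4). [LiebPRL1989]
* H. Tasaki, *Physics and Mathematics of Quantum Many-Body Systems* (2020), §9.2–9.3
  (Jordan–Wigner fermions, Hubbard model, spin operators). [Tasaki2020]
-/

namespace Literature.MathematicalPhysics.QuantumLattice

open Matrix Finset

/-! ### Spin-resolved occupation sets -/

section PairSet

variable {Λ : Type*} [LinearOrder Λ] [Fintype Λ]

/-- The set of sites carrying an up (`σ = 0`) electron in the configuration `s`.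
Lieb, PRL 62 (1989) 1201, proof of Theorem 1 (`α` = positions of the up electrons). [cite: LiebPRL1989, proof of Theorem 1] -/
def upPart (s : Finset (Orb Λ)) : Finset Λ := univ.filter fun x => orb x 0 ∈ s

/-- The set of sites carrying a down (`σ = 1`) electron in the configuration `s`.
Lieb, PRL 62 (1989) 1201, proof of Theorem 1 (`β` = positions of the down electrons). [cite: LiebPRL1989, proof of Theorem 1] -/
def downPart (s : Finset (Orb Λ)) : Finset Λ := univ.filter fun x => orb x 1 ∈ s

/-- The configuration `α↑ ∪ β↓` with up electrons on `α` and down electrons on `β` (the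
occupation basis vector `|α↑ ∪ β↓⟩` is `± ψ^α_↑ ⊗ ψ^β_↓`).
Lieb, PRL 62 (1989) 1201, proof of Theorem 1. [cite: LiebPRL1989, proof of Theorem 1] -/
def pairSet (α β : Finset Λ) : Finset (Orb Λ) :=
  univ.filter fun i => ((ofLex i).2 = 0 ∧ (ofLex i).1 ∈ α) ∨ ((ofLex i).2 = 1 ∧ (ofLex i).1 ∈ β)

/-- Membership in `upPart`. [folklore] -/
@[simp] theorem mem_upPart (s : Finset (Orb Λ)) (x : Λ) : x ∈ upPart s ↔ orb x 0 ∈ s := by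
  simp [upPart]

/-- Membership in `downPart`. [folklore] -/
@[simp] theorem mem_downPart (s : Finset (Orb Λ)) (x : Λ) : x ∈ downPart s ↔ orb x 1 ∈ s := by
  simp [downPart]

/-- Membership in `pairSet`. [folklore] -/
theorem mem_pairSet (α β : Finset Λ) (i : Orb Λ) :
    i ∈ pairSet α β ↔
      ((ofLex i).2 = 0 ∧ (ofLex i).1 ∈ α) ∨ ((ofLex i).2 = 1 ∧ (ofLex i).1 ∈ β) := by
  simp [pairSet]

/-- `x↑ ∈ α↑ ∪ β↓ ↔ x ∈ α`. [folklore] -/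
@[simp] theorem orb_zero_mem_pairSet (α β : Finset Λ) (x : Λ) :
    orb x 0 ∈ pairSet α β ↔ x ∈ α := by
  simp [mem_pairSet]

/-- `x↓ ∈ α↑ ∪ β↓ ↔ x ∈ β`. [folklore] -/
@[simp] theorem orb_one_mem_pairSet (α β : Finset Λ) (x : Λ) :
    orb x 1 ∈ pairSet α β ↔ x ∈ β := by
  simp [mem_pairSet]

omit [LinearOrder Λ] [Fintype Λ] in
/-- Every orbital is `x↑` or `x↓`. [folklore] -/
theorem orb_cases (i : Orb Λ) : i = orb (ofLex i).1 0 ∨ i = orb (ofLex i).1 1 := by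
  obtain ⟨x, σ⟩ := i
  fin_cases σ
  · exact Or.inl rfl
  · exact Or.inr rfl

omit [LinearOrder Λ] [Fintype Λ] in
/-- `orb` is injective in both arguments. [folklore] -/
theorem orb_inj {x y : Λ} {σ τ : Fin 2} : orb x σ = orb y τ ↔ x = y ∧ σ = τ := by
  simp [orb]

/-- `upPart (α↑ ∪ β↓) = α`. [folklore] -/
@[simp] theorem upPart_pairSet (α β : Finset Λ) : upPart (pairSet α β) = α := by
  ext x; simp

/-- `downPart (α↑ ∪ β↓) = β`. [folklore] -/
@[simp] theorem downPart_pairSet (α β : Finset Λ) : downPart (pairSet α β) = β := by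
  ext x; simp

/-- Every configuration is `α↑ ∪ β↓` with `α`, `β` its up and down parts. [folklore] -/
@[simp] theorem pairSet_upPart_downPart (s : Finset (Orb Λ)) :
    pairSet (upPart s) (downPart s) = s := by
  ext i
  rcases orb_cases i with h | h <;> rw [h] <;> simp

/-- Configurations of spin orbitals correspond to pairs (up set, down set): the factorisation of
the Fock space over `Λ × {↑, ↓}` as a tensor product of two spinless Fock spaces.
Lieb, PRL 62 (1989) 1201, proof of Theorem 1. [cite: LiebPRL1989, proof of Theorem 1] -/
def configEquiv : Finset (Orb Λ) ≃ Finset Λ × Finset Λ where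
  toFun s := (upPart s, downPart s)
  invFun p := pairSet p.1 p.2
  left_inv s := pairSet_upPart_downPart s
  right_inv p := by simp

/-- `pairSet` is injective. [folklore] -/
theorem pairSet_injective {α β α' β' : Finset Λ} (h : pairSet α β = pairSet α' β') :
    α = α' ∧ β = β' := by
  have h1 := congrArg upPart h
  have h2 := congrArg downPart h
  simp only [upPart_pairSet, downPart_pairSet] at h1 h2
  exact ⟨h1, h2⟩

/-- `α↑ ∪ β↓` as a (disjoint) union of two embedded copies. [folklore] -/
theorem pairSet_eq_union_map (α β : Finset Λ) :
    pairSet α β =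
      α.map ⟨fun x => orb x 0, fun x y h => by simpa using congrArg (fun i => (ofLex i).1) h⟩ ∪
        β.map ⟨fun x => orb x 1, fun x y h => by simpa using congrArg (fun i => (ofLex i).1) h⟩ := by
  ext i
  rcases orb_cases i with h | h <;> rw [h] <;> simp [Finset.mem_map]

/-- `#(α↑ ∪ β↓) = #α + #β`. [folklore] -/
theorem card_pairSet (α β : Finset Λ) : (pairSet α β).card = α.card + β.card := by
  rw [pairSet_eq_union_map, card_union_of_disjoint, card_map, card_map]
  rw [Finset.disjoint_left]
  intro i hi hi'
  simp only [Finset.mem_map, Function.Embedding.coeFn_mk] at hi hi'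
  obtain ⟨x, -, rfl⟩ := hi
  obtain ⟨y, -, hy⟩ := hi'
  simpa using congrArg (fun i => (ofLex i).2) hy

/-- The particle number is the number of up plus the number of down electrons. [folklore] -/
theorem card_eq_upPart_add_downPart (s : Finset (Orb Λ)) :
    s.card = (upPart s).card + (downPart s).card := by
  conv_lhs => rw [← pairSet_upPart_downPart s]
  exact card_pairSet _ _

/-- Removing an up electron. [folklore] -/
theorem pairSet_erase_zero (α β : Finset Λ) (x : Λ) :
    (pairSet α β).erase (orb x 0) = pairSet (α.erase x) β := by
  ext i
  rcases orb_cases i with h | h <;> rw [h] <;> simp [mem_erase, and_comm]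

/-- Removing a down electron. [folklore] -/
theorem pairSet_erase_one (α β : Finset Λ) (x : Λ) :
    (pairSet α β).erase (orb x 1) = pairSet α (β.erase x) := by
  ext i
  rcases orb_cases i with h | h <;> rw [h] <;> simp [mem_erase, and_comm]

/-- Adding an up electron. [folklore] -/
theorem pairSet_insert_zero (α β : Finset Λ) (x : Λ) :
    insert (orb x 0) (pairSet α β) = pairSet (insert x α) β := by
  ext i
  rcases orb_cases i with h | h <;> rw [h] <;> simp [mem_insert]

/-- Adding a down electron. [folklore] -/
theorem pairSet_insert_one (α β : Finset Λ) (x : Λ) :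
    insert (orb x 1) (pairSet α β) = pairSet α (insert x β) := by
  ext i
  rcases orb_cases i with h | h <;> rw [h] <;> simp [mem_insert]

/-! ### Jordan–Wigner signs of spin orbitals -/

omit [Fintype Λ] in
/-- In the orbital order `x₁↑ < x₁↓ < x₂↑ < ⋯` of `HubbardWave0`, `yτ < x↑ ↔ y < x`.
Tasaki (2020) §9.2.1 (ordering of the orbitals in the Jordan–Wigner construction). [cite: Tasaki2020, §9.2.1] -/
theorem orb_lt_orb_zero_iff (y : Λ) (τ : Fin 2) (x : Λ) : orb y τ < orb x 0 ↔ y < x := by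
  rw [Prod.Lex.toLex_lt_toLex]
  constructor
  · rintro (h | ⟨-, h⟩)
    · exact h
    · exact absurd h (Fin.not_lt_zero τ)
  · exact Or.inl

omit [Fintype Λ] in
/-- `yτ < x↓ ↔ y < x ∨ (y = x ∧ τ = ↑)`. Tasaki (2020) §9.2.1. [cite: Tasaki2020, §9.2.1] -/
theorem orb_lt_orb_one_iff (y : Λ) (τ : Fin 2) (x : Λ) :
    orb y τ < orb x 1 ↔ y < x ∨ (y = x ∧ τ = 0) := by
  rw [Prod.Lex.toLex_lt_toLex]
  constructor
  · rintro (h | ⟨h1, h2⟩)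
    · exact Or.inl h
    · refine Or.inr ⟨h1, ?_⟩
      fin_cases τ
      · rfl
      · exact absurd h2 (lt_irrefl _)
  · rintro (h | ⟨rfl, rfl⟩)
    · exact Or.inl h
    · exact Or.inr ⟨rfl, Fin.zero_lt_one⟩

/-- The orbitals of `α↑ ∪ β↓` below `x↑`. Tasaki (2020) §9.2.1. [cite: Tasaki2020, §9.2.1] -/
theorem pairSet_filter_lt_zero (α β : Finset Λ) (x : Λ) :
    (pairSet α β).filter (· < orb x 0) = pairSet (α.filter (· < x)) (β.filter (· < x)) := by
  ext i
  rcases orb_cases i with h | h <;> rw [h] <;> simp [mem_filter, orb_lt_orb_zero_iff]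

/-- The orbitals of `α↑ ∪ β↓` below `x↓`. Tasaki (2020) §9.2.1. [cite: Tasaki2020, §9.2.1] -/
theorem pairSet_filter_lt_one (α β : Finset Λ) (x : Λ) :
    (pairSet α β).filter (· < orb x 1) = pairSet (α.filter (· ≤ x)) (β.filter (· < x)) := by
  ext i
  rcases orb_cases i with h | h <;> rw [h] <;>
    simp [mem_filter, orb_lt_orb_one_iff, le_iff_lt_or_eq]

/-- Jordan–Wigner sign of an up orbital: `jwSign (x↑) (α↑ ∪ β↓) = jwSign x α · jwSign x β`
(the spinless sign of `x` in `α` times the sign from the down electrons below `x`).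
Tasaki (2020) §9.2.1. [cite: Tasaki2020, §9.2.1] -/
theorem jwSign_orb_zero (α β : Finset Λ) (x : Λ) :
    jwSign (orb x 0) (pairSet α β) = jwSign x α * jwSign x β := by
  rw [jwSign, pairSet_filter_lt_zero, card_pairSet, pow_add]
  rfl

omit [Fintype Λ] in
/-- The sign `(-1)^{#{a ∈ α | a ≤ x}}`. Tasaki (2020) §9.2.1. [cite: Tasaki2020, §9.2.1] -/
def leSign (x : Λ) (α : Finset Λ) : ℂ := (-1) ^ (α.filter (· ≤ x)).card

omit [Fintype Λ] in
/-- The sign `(-1)^{#{a ∈ α | x < a}}`. Tasaki (2020) §9.2.1. [cite: Tasaki2020, §9.2.1] -/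
def gtSign (x : Λ) (α : Finset Λ) : ℂ := (-1) ^ (α.filter (x < ·)).card

/-- Jordan–Wigner sign of a down orbital: `jwSign (x↓) (α↑ ∪ δ↓) = leSign x α · jwSign x δ`.
Tasaki (2020) §9.2.1. [cite: Tasaki2020, §9.2.1] -/
theorem jwSign_orb_one (α δ : Finset Λ) (x : Λ) :
    jwSign (orb x 1) (pairSet α δ) = leSign x α * jwSign x δ := by
  rw [jwSign, pairSet_filter_lt_one, card_pairSet, pow_add]
  rfl

omit [Fintype Λ] in
/-- `leSign x α · gtSign x α = (-1)^{#α}`. [folklore] -/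
theorem leSign_mul_gtSign (x : Λ) (α : Finset Λ) : leSign x α * gtSign x α = (-1) ^ α.card := by
  rw [leSign, gtSign, ← pow_add]
  congr 1
  convert Finset.card_filter_add_card_filter_not (fun a => a ≤ x) using 3
  ext a
  simp [not_le]

omit [Fintype Λ] in
/-- `leSign` is a sign. [folklore] -/
theorem leSign_mul_self (x : Λ) (α : Finset Λ) : leSign x α * leSign x α = 1 := by
  rw [leSign, ← mul_pow, neg_mul_neg, one_mul, one_pow]

omit [Fintype Λ] in
/-- `gtSign` is a sign. [folklore] -/
theorem gtSign_mul_self (x : Λ) (α : Finset Λ) : gtSign x α * gtSign x α = 1 := by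
  rw [gtSign, ← mul_pow, neg_mul_neg, one_mul, one_pow]

omit [Fintype Λ] in
/-- Lieb's sign `σ(α, β) = ∏_{a ∈ α} jwSign a β = (-1)^{#{(a,b) ∈ α × β | b < a}}` between the
occupation basis vector `|α↑ ∪ β↓⟩` and the product state `ψ^α_↑ ⊗ ψ^β_↓` ("some arbitrary
convention for the sign of the `ψ^α`'s can be made here").
Lieb, PRL 62 (1989) 1201, proof of Theorem 1. [cite: LiebPRL1989, proof of Theorem 1] -/
def pairSign (α β : Finset Λ) : ℂ := ∏ a ∈ α, jwSign a β

omit [Fintype Λ] in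
/-- `σ(γ ∪ x, β) = jwSign x β · σ(γ, β)`. [folklore] -/
theorem pairSign_insert_left {x : Λ} {γ : Finset Λ} (hx : x ∉ γ) (β : Finset Λ) :
    pairSign (insert x γ) β = jwSign x β * pairSign γ β := by
  rw [pairSign, prod_insert hx, pairSign]

end PairSet

/-! ### Spin sectors -/

section Sectors

variable {Λ : Type*} [LinearOrder Λ] [Fintype Λ]

/-- `ψ` lies in the sector with `a` up and `b` down electrons (`N↑ = a`, `N↓ = b`; the
`S^z = 0` sector of Lieb's proof is `a = b = n`).
Lieb, PRL 62 (1989) 1201, proof of Theorem 1. [cite: LiebPRL1989, proof of Theorem 1] -/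
def IsInSector (a b : ℕ) (ψ : Fock (Orb Λ)) : Prop :=
  ∀ s, ¬((upPart s).card = a ∧ (downPart s).card = b) → ψ s = 0

/-- The restriction of a wave function to the `(a, b)` sector (orthogonal projection).
Lieb, PRL 62 (1989) 1201, proof of Theorem 1 ("all competitors have a representative there"). [cite: LiebPRL1989, proof of Theorem 1] -/
def sectorProj (a b : ℕ) (ψ : Fock (Orb Λ)) : Fock (Orb Λ) :=
  fun s => if (upPart s).card = a ∧ (downPart s).card = b then ψ s else 0

/-- Unfolding lemma for `sectorProj`. [folklore] -/
theorem sectorProj_apply (a b : ℕ) (ψ : Fock (Orb Λ)) (s : Finset (Orb Λ)) :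
    sectorProj a b ψ s = if (upPart s).card = a ∧ (downPart s).card = b then ψ s else 0 := rfl

/-- `sectorProj a b ψ` lies in the sector `(a, b)`. [folklore] -/
theorem isInSector_sectorProj (a b : ℕ) (ψ : Fock (Orb Λ)) :
    IsInSector a b (sectorProj a b ψ) :=
  fun _ hs => if_neg hs

/-- `sectorProj` is the identity on its sector. [folklore] -/
theorem sectorProj_eq_self {a b : ℕ} {ψ : Fock (Orb Λ)} (h : IsInSector a b ψ) :
    sectorProj a b ψ = ψ := by
  funext s
  rw [sectorProj_apply]
  split_ifs with hs
  · rfl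
  · exact (h s hs).symm

/-- `sectorProj` is linear (scalars). [folklore] -/
theorem sectorProj_smul (a b : ℕ) (c : ℂ) (ψ : Fock (Orb Λ)) :
    sectorProj a b (c • ψ) = c • sectorProj a b ψ := by
  funext s
  simp only [sectorProj_apply, Pi.smul_apply, smul_eq_mul, mul_ite, mul_zero]

/-- A vector of the `(a, b)` sector is an `(a + b)`-particle vector. [folklore] -/
theorem IsInSector.isNParticle {a b : ℕ} {ψ : Fock (Orb Λ)} (h : IsInSector a b ψ) :
    IsNParticle (a + b) ψ := by
  intro s hs
  refine h s fun h' => hs ?_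
  rw [card_eq_upPart_add_downPart, h'.1, h'.2]

/-- `0` lies in every sector. [folklore] -/
theorem IsInSector.zero (a b : ℕ) : IsInSector a b (0 : Fock (Orb Λ)) := fun _ _ => rfl

/-- Sectors are closed under addition. [folklore] -/
theorem IsInSector.add {a b : ℕ} {ψ φ : Fock (Orb Λ)} (hψ : IsInSector a b ψ)
    (hφ : IsInSector a b φ) : IsInSector a b (ψ + φ) := fun s hs => by
  rw [Pi.add_apply, hψ s hs, hφ s hs, add_zero]

/-- Sectors are closed under scalars. [folklore] -/
theorem IsInSector.smul {a b : ℕ} {ψ : Fock (Orb Λ)} (hψ : IsInSector a b ψ) (c : ℂ) :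
    IsInSector a b (c • ψ) := fun s hs => by
  rw [Pi.smul_apply, hψ s hs, smul_zero]

/-- Sectors are closed under subtraction. [folklore] -/
theorem IsInSector.sub {a b : ℕ} {ψ φ : Fock (Orb Λ)} (hψ : IsInSector a b ψ)
    (hφ : IsInSector a b φ) : IsInSector a b (ψ - φ) := fun s hs => by
  rw [Pi.sub_apply, hψ s hs, hφ s hs, sub_zero]

/-- An `N`-particle vector is the sum of its sector components `(a, N - a)`, `a = 0, …, N`.
Lieb, PRL 62 (1989) 1201, proof of Theorem 1 (`S^z` is conserved). [cite: LiebPRL1989, proof of Theorem 1] -/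
theorem sum_sectorProj_eq {N : ℕ} {ψ : Fock (Orb Λ)} (hψ : IsNParticle N ψ) :
    ∑ a ∈ range (N + 1), sectorProj a (N - a) ψ = ψ := by
  funext s
  rw [Finset.sum_apply]
  simp only [sectorProj_apply]
  by_cases hs : s.card = N
  · have hsum : (upPart s).card + (downPart s).card = N := by
      rw [← card_eq_upPart_add_downPart, hs]
    rw [Finset.sum_eq_single (upPart s).card]
    · rw [if_pos ⟨rfl, by omega⟩]
    · intro a _ ha
      rw [if_neg]
      exact fun h => ha h.1.symm
    · intro h
      exfalso
      apply h
      rw [mem_range]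
      omega
  · rw [hψ s hs]
    refine Finset.sum_eq_zero fun a ha => ?_
    rw [mem_range] at ha
    rw [if_neg]
    rintro ⟨h1, h2⟩
    apply hs
    rw [card_eq_upPart_add_downPart, h1, h2]
    omega

/-! ### Sector-preserving, spin-raising and spin-lowering matrices -/

/-- `M` is block diagonal with respect to the spin sectors (conserves `N↑` and `N↓`, like `H`).
Lieb, PRL 62 (1989) 1201, Remark (2)(i). [cite: LiebPRL1989, Remark (2)] -/
def PreservesSectors (M : Matrix (Finset (Orb Λ)) (Finset (Orb Λ)) ℂ) : Prop :=
  ∀ s s', M s s' ≠ 0 →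
    (upPart s).card = (upPart s').card ∧ (downPart s).card = (downPart s').card

/-- `M` maps the sector `(a, b + 1)` to `(a + 1, b)` (like `S⁺`). Tasaki (2020) §9.3. [cite: Tasaki2020, §9.3] -/
def RaisesSpin (M : Matrix (Finset (Orb Λ)) (Finset (Orb Λ)) ℂ) : Prop :=
  ∀ s s', M s s' ≠ 0 →
    (upPart s).card = (upPart s').card + 1 ∧ (downPart s).card + 1 = (downPart s').card

/-- `M` maps the sector `(a + 1, b)` to `(a, b + 1)` (like `S⁻`). Tasaki (2020) §9.3. [cite: Tasaki2020, §9.3] -/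
def LowersSpin (M : Matrix (Finset (Orb Λ)) (Finset (Orb Λ)) ℂ) : Prop :=
  ∀ s s', M s s' ≠ 0 →
    (upPart s).card + 1 = (upPart s').card ∧ (downPart s).card = (downPart s').card + 1

namespace PreservesSectors

/-- `0` preserves sectors. [folklore] -/
theorem zero : PreservesSectors (0 : Matrix (Finset (Orb Λ)) (Finset (Orb Λ)) ℂ) :=
  fun _ _ h => absurd rfl h

/-- Sums of sector-preserving matrices preserve sectors. [folklore] -/
theorem add {M N : Matrix (Finset (Orb Λ)) (Finset (Orb Λ)) ℂ} (hM : PreservesSectors M)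
    (hN : PreservesSectors N) : PreservesSectors (M + N) := by
  intro s s' h
  by_cases hMs : M s s' = 0
  · rw [Matrix.add_apply, hMs, zero_add] at h
    exact hN s s' h
  · exact hM s s' hMs

/-- Scalar multiples of sector-preserving matrices preserve sectors. [folklore] -/
theorem smul {M : Matrix (Finset (Orb Λ)) (Finset (Orb Λ)) ℂ} (hM : PreservesSectors M)
    (c : ℂ) : PreservesSectors (c • M) :=
  fun s s' h => hM s s' fun h' => h (by simp [h'])

/-- Finite sums of sector-preserving matrices preserve sectors. [folklore] -/
theorem sum {ι : Type*} {S : Finset ι} {M : ι → Matrix (Finset (Orb Λ)) (Finset (Orb Λ)) ℂ}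
    (hM : ∀ i ∈ S, PreservesSectors (M i)) : PreservesSectors (∑ i ∈ S, M i) := by
  classical
  induction S using Finset.induction_on with
  | empty => rw [sum_empty]; exact zero
  | @insert i S hi ih =>
    rw [sum_insert hi]
    exact (hM i (mem_insert_self i S)).add (ih fun j hj => hM j (mem_insert_of_mem hj))

/-- `if p then M else 0` preserves sectors if `M` does. [folklore] -/
theorem ite {M : Matrix (Finset (Orb Λ)) (Finset (Orb Λ)) ℂ} (hM : PreservesSectors M)
    (p : Prop) [Decidable p] : PreservesSectors (if p then M else 0) := by
  split_ifs
  · exact hM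
  · exact zero

/-- Products of sector-preserving matrices preserve sectors. [folklore] -/
theorem mul {M N : Matrix (Finset (Orb Λ)) (Finset (Orb Λ)) ℂ} (hM : PreservesSectors M)
    (hN : PreservesSectors N) : PreservesSectors (M * N) := by
  intro s s'' h
  rw [Matrix.mul_apply] at h
  obtain ⟨s', -, hs'⟩ := Finset.exists_ne_zero_of_sum_ne_zero h
  have h1 := hM s s' (left_ne_zero_of_mul hs')
  have h2 := hN s' s'' (right_ne_zero_of_mul hs')
  exact ⟨h1.1.trans h2.1, h1.2.trans h2.2⟩

/-- Diagonal matrices preserve sectors. [folklore] -/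
theorem diagonal (d : Finset (Orb Λ) → ℂ) : PreservesSectors (Matrix.diagonal d) := by
  intro s s' h
  by_cases hss' : s = s'
  · subst hss'
    exact ⟨rfl, rfl⟩
  · exact absurd (diagonal_apply_ne d hss') h

/-- A sector-preserving matrix commutes with the sector projections. [folklore] -/
theorem mulVec_sectorProj {M : Matrix (Finset (Orb Λ)) (Finset (Orb Λ)) ℂ}
    (hM : PreservesSectors M) (a b : ℕ) (ψ : Fock (Orb Λ)) :
    M *ᵥ sectorProj a b ψ = sectorProj a b (M *ᵥ ψ) := by
  funext s
  rw [sectorProj_apply, mulVec, mulVec, dotProduct, dotProduct]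
  simp only [sectorProj_apply]
  split_ifs with hs
  · refine Finset.sum_congr rfl fun s' _ => ?_
    split_ifs with hs'
    · rfl
    · rw [mul_zero]
      by_cases hMs : M s s' = 0
      · rw [hMs, zero_mul]
      · exact absurd ⟨(hM s s' hMs).1 ▸ hs.1, (hM s s' hMs).2 ▸ hs.2⟩ hs'
  · refine Finset.sum_eq_zero fun s' _ => ?_
    split_ifs with hs'
    · by_cases hMs : M s s' = 0
      · rw [hMs, zero_mul]
      · exact absurd ⟨(hM s s' hMs).1.trans hs'.1, (hM s s' hMs).2.trans hs'.2⟩ hs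
    · rw [mul_zero]

/-- A sector-preserving matrix maps each sector to itself. [folklore] -/
theorem isInSector_mulVec {M : Matrix (Finset (Orb Λ)) (Finset (Orb Λ)) ℂ}
    (hM : PreservesSectors M) {a b : ℕ} {ψ : Fock (Orb Λ)} (hψ : IsInSector a b ψ) :
    IsInSector a b (M *ᵥ ψ) := by
  rw [← sectorProj_eq_self hψ, hM.mulVec_sectorProj]
  exact isInSector_sectorProj a b _

/-- A sector-preserving matrix commutes with every diagonal matrix whose entries depend only on
the sector (used for `[H, N] = [H, S^z] = 0`). [folklore] -/
theorem commute_diagonal {M : Matrix (Finset (Orb Λ)) (Finset (Orb Λ)) ℂ}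
    (hM : PreservesSectors M) (f : ℕ → ℕ → ℂ) :
    Commute M (Matrix.diagonal fun s => f (upPart s).card (downPart s).card) := by
  rw [Commute, SemiconjBy]
  ext s s'
  rw [mul_diagonal, diagonal_mul]
  by_cases h : M s s' = 0
  · rw [h, mul_zero, zero_mul]
  · rw [(hM s s' h).1, (hM s s' h).2, mul_comm]

end PreservesSectors

/-- A spin-raising matrix maps the sector `(a, b + 1)` to `(a + 1, b)`. Tasaki (2020) §9.3. [cite: Tasaki2020, §9.3] -/
theorem RaisesSpin.isInSector_mulVec {M : Matrix (Finset (Orb Λ)) (Finset (Orb Λ)) ℂ}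
    (hM : RaisesSpin M) {a b : ℕ} {ψ : Fock (Orb Λ)} (hψ : IsInSector a (b + 1) ψ) :
    IsInSector (a + 1) b (M *ᵥ ψ) := by
  intro s hs
  rw [mulVec, dotProduct]
  refine Finset.sum_eq_zero fun s' _ => ?_
  by_cases hMs : M s s' = 0
  · rw [hMs, zero_mul]
  · by_cases hs' : (upPart s').card = a ∧ (downPart s').card = b + 1
    · exfalso
      refine hs ⟨?_, ?_⟩
      · rw [(hM s s' hMs).1, hs'.1]
      · have := (hM s s' hMs).2
        rw [hs'.2] at this
        exact Nat.add_right_cancel this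
    · rw [hψ s' hs', mul_zero]

/-- A spin-raising matrix kills the sectors without down electrons. Tasaki (2020) §9.3. [cite: Tasaki2020, §9.3] -/
theorem RaisesSpin.mulVec_eq_zero {M : Matrix (Finset (Orb Λ)) (Finset (Orb Λ)) ℂ}
    (hM : RaisesSpin M) {a : ℕ} {ψ : Fock (Orb Λ)} (hψ : IsInSector a 0 ψ) : M *ᵥ ψ = 0 := by
  funext s
  rw [mulVec, dotProduct, Pi.zero_apply]
  refine Finset.sum_eq_zero fun s' _ => ?_
  by_cases hMs : M s s' = 0
  · rw [hMs, zero_mul]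
  · rw [hψ s' (fun h => by have := (hM s s' hMs).2; omega), mul_zero]

/-- A spin-lowering matrix maps the sector `(a + 1, b)` to `(a, b + 1)`. Tasaki (2020) §9.3. [cite: Tasaki2020, §9.3] -/
theorem LowersSpin.isInSector_mulVec {M : Matrix (Finset (Orb Λ)) (Finset (Orb Λ)) ℂ}
    (hM : LowersSpin M) {a b : ℕ} {ψ : Fock (Orb Λ)} (hψ : IsInSector (a + 1) b ψ) :
    IsInSector a (b + 1) (M *ᵥ ψ) := by
  intro s hs
  rw [mulVec, dotProduct]
  refine Finset.sum_eq_zero fun s' _ => ?_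
  by_cases hMs : M s s' = 0
  · rw [hMs, zero_mul]
  · by_cases hs' : (upPart s').card = a + 1 ∧ (downPart s').card = b
    · exfalso
      refine hs ⟨?_, ?_⟩
      · have := (hM s s' hMs).1
        rw [hs'.1] at this
        exact Nat.add_right_cancel this
      · rw [(hM s s' hMs).2, hs'.2]
    · rw [hψ s' hs', mul_zero]

/-- A spin-lowering matrix kills the sectors without up electrons. Tasaki (2020) §9.3. [cite: Tasaki2020, §9.3] -/
theorem LowersSpin.mulVec_eq_zero {M : Matrix (Finset (Orb Λ)) (Finset (Orb Λ)) ℂ}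
    (hM : LowersSpin M) {b : ℕ} {ψ : Fock (Orb Λ)} (hψ : IsInSector 0 b ψ) : M *ᵥ ψ = 0 := by
  funext s
  rw [mulVec, dotProduct, Pi.zero_apply]
  refine Finset.sum_eq_zero fun s' _ => ?_
  by_cases hMs : M s s' = 0
  · rw [hMs, zero_mul]
  · rw [hψ s' (fun h => by have := (hM s s' hMs).1; omega), mul_zero]

/-- The conjugate transpose of a spin-raising matrix is spin-lowering (`S⁻ = (S⁺)†`).
Lieb, PRL 62 (1989) 1201, eq. (2). [cite: LiebPRL1989, eq. (2)] -/
theorem RaisesSpin.conjTranspose {M : Matrix (Finset (Orb Λ)) (Finset (Orb Λ)) ℂ}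
    (hM : RaisesSpin M) : LowersSpin Mᴴ := by
  intro s s' h
  rw [conjTranspose_apply, ne_eq, star_eq_zero] at h
  exact ⟨(hM s' s h).1.symm, (hM s' s h).2.symm⟩

/-- Finite sums of spin-raising matrices are spin-raising. [folklore] -/
theorem RaisesSpin.sum {ι : Type*} {S : Finset ι}
    {M : ι → Matrix (Finset (Orb Λ)) (Finset (Orb Λ)) ℂ} (hM : ∀ i ∈ S, RaisesSpin (M i)) :
    RaisesSpin (∑ i ∈ S, M i) := by
  intro s s' h
  rw [Matrix.sum_apply] at h
  obtain ⟨i, hi, hi'⟩ := Finset.exists_ne_zero_of_sum_ne_zero h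
  exact hM i hi s s' hi'

end Sectors

/-! ### Spinless configurations, Lieb's matrices `K` and `L_x`, hopping moves -/

section Hop

variable {Λ : Type*} [DecidableEq Λ] (G : SimpleGraph Λ)

/-- One hopping move between spinless-fermion configurations: a particle hops from the occupied
site `y ∈ α` to an empty neighbouring site `x ∉ α` (a nonzero matrix element of `K`).
Lieb, PRL 62 (1989) 1201, proof of Theorem 1 ("the `α`'s are connected by `K`"). [cite: LiebPRL1989, proof of Theorem 1] -/
def IsHop (α β : Finset Λ) : Prop :=
  ∃ x y, G.Adj x y ∧ y ∈ α ∧ x ∉ α ∧ β = insert x (α.erase y)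

variable {G}

/-- Hopping moves preserve the particle number. [folklore] -/
theorem IsHop.card_eq {α β : Finset Λ} (h : IsHop G α β) : β.card = α.card := by
  obtain ⟨x, y, -, hy, hx, rfl⟩ := h
  rw [card_insert_of_notMem (fun h' => hx (mem_of_mem_erase h')), card_erase_of_mem hy]
  exact Nat.sub_add_cancel (card_pos.2 ⟨y, hy⟩)

/-- Chains of hopping moves preserve the particle number. [folklore] -/
theorem card_eq_of_reflTransGen_isHop {α β : Finset Λ}
    (h : Relation.ReflTransGen (IsHop G) α β) : β.card = α.card := by
  induction h with
  | refl => rfl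
  | tail _ hbc ih => rw [hbc.card_eq, ih]

/-- Moving a hole along a walk: if `a ∉ α`, `b ∈ α` and `a`, `b` are joined by a walk, then
hopping moves lead from `α` to `α - b + a` (induction on the walk; when the next site is
occupied, that particle hops first).
Lieb, PRL 62 (1989) 1201, proof of Theorem 1 ("it is easy to see that the `α`'s are connected
by `K`"). [cite: LiebPRL1989, proof of Theorem 1] -/
theorem reflTransGen_isHop_of_walk {a b : Λ} (p : G.Walk a b) :
    ∀ α : Finset Λ, a ∉ α → b ∈ α →
      Relation.ReflTransGen (IsHop G) α (insert a (α.erase b)) := by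
  induction p with
  | nil => intro α ha hb; exact absurd hb ha
  | @cons u v w huv p ih =>
    intro α hu hw
    have huw : u ≠ w := fun h => hu (h ▸ hw)
    by_cases hv : v ∈ α
    · have h1 : IsHop G α (insert u (α.erase v)) := ⟨u, v, huv, hv, hu, rfl⟩
      by_cases hvw : v = w
      · subst hvw
        exact Relation.ReflTransGen.single h1
      · have hv' : v ∉ insert u (α.erase v) := by simp [huv.ne.symm]
        have hw' : w ∈ insert u (α.erase v) := by simp [hw, Ne.symm hvw]
        have h2 := ih (insert u (α.erase v)) hv' hw'
        have heq : insert v ((insert u (α.erase v)).erase w) = insert u (α.erase w) := by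
          rw [erase_insert_of_ne huw, erase_right_comm, Finset.insert_comm,
            insert_erase (mem_erase.2 ⟨hvw, hv⟩)]
        rw [heq] at h2
        exact Relation.ReflTransGen.head h1 h2
    · have h1 := ih α hv hw
      have hu' : u ∉ insert v (α.erase w) := by simp [huv.ne, hu]
      have h2 : IsHop G (insert v (α.erase w)) (insert u ((insert v (α.erase w)).erase v)) :=
        ⟨u, v, huv, mem_insert_self v _, hu', rfl⟩
      rw [erase_insert (fun h => hv (mem_of_mem_erase h))] at h2
      exact Relation.ReflTransGen.tail h1 h2

/-- On a connected graph any two configurations with the same number of particles are joined by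
hopping moves. Lieb, PRL 62 (1989) 1201, proof of Theorem 1. [cite: LiebPRL1989, proof of Theorem 1] -/
theorem reflTransGen_isHop (hG : G.Preconnected) {α β : Finset Λ} (h : α.card = β.card) :
    Relation.ReflTransGen (IsHop G) α β := by
  induction hk : (α \ β).card generalizing α with
  | zero =>
    have hsub : α ⊆ β := by
      rw [← sdiff_eq_empty_iff_subset, ← card_eq_zero]
      exact hk
    rw [eq_of_subset_of_card_le hsub h.ge]
  | succ k ih =>
    obtain ⟨b, hb⟩ : (α \ β).Nonempty := card_pos.1 (by omega)
    have hk' : (β \ α).card = k + 1 := by rw [card_sdiff_comm h.symm, hk]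
    obtain ⟨a, ha⟩ : (β \ α).Nonempty := card_pos.1 (by omega)
    rw [mem_sdiff] at ha hb
    obtain ⟨p⟩ := hG a b
    have h1 := reflTransGen_isHop_of_walk p α ha.2 hb.1
    have hcard : (insert a (α.erase b)).card = β.card := by
      rw [← h, card_eq_of_reflTransGen_isHop h1]
    have hk2 : (insert a (α.erase b) \ β).card = k := by
      have : insert a (α.erase b) \ β = (α \ β).erase b := by
        ext z
        simp only [mem_sdiff, mem_insert, mem_erase]
        constructor
        · rintro ⟨h | ⟨h1, h2⟩, h3⟩
          · exact absurd ha.1 (h ▸ h3)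
          · exact ⟨h1, h2, h3⟩
        · rintro ⟨h1, h2, h3⟩
          exact ⟨Or.inr ⟨h1, h2⟩, h3⟩
      rw [this, card_erase_of_mem (mem_sdiff.2 hb), hk]
      rfl
    exact h1.trans (ih hcard hk2)

end Hop

section LiebMatrices

variable {Λ : Type*} [LinearOrder Λ] [Fintype Λ] (G : SimpleGraph Λ) [DecidableRel G.Adj]

/-- The spinless hopping operator `T = -t Σ_{x ∼ y} c†_x c_y` on the Fock space over `Λ`
(ordered adjacent pairs, so each bond contributes a term and its conjugate), i.e. one spin
component of the hopping term of `hamiltonian`. Lieb, PRL 62 (1989) 1201, eq. (1) and the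
matrix `K` of eq. (3). [cite: LiebPRL1989, eqs. (1), (3)] -/
def hoppingMatrix (t : ℝ) : Matrix (Finset Λ) (Finset Λ) ℂ :=
  -(t : ℂ) • ∑ x : Λ, ∑ y : Λ, if G.Adj x y then creation x * annihilation y else 0

/-- The `n`-particle configurations of spinless fermions on `Λ` (`n`-element subsets; Lieb's
index set `{α}` of size `m = (|Λ| choose n)`).
Lieb, PRL 62 (1989) 1201, proof of Theorem 1. [cite: LiebPRL1989, proof of Theorem 1] -/
abbrev Config (Λ : Type*) (n : ℕ) : Type _ := {α : Finset Λ // α.card = n}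

/-- Lieb's matrix `K`: the hopping matrix in the occupation basis of `n` spinless fermions
(`K_{αβ} = ⟨ψ^β| Σ t_{xy} c†_x c_y |ψ^α⟩`, real symmetric).
Lieb, PRL 62 (1989) 1201, eq. (3). [cite: LiebPRL1989, eq. (3)] -/
def liebK (t : ℝ) (n : ℕ) : Matrix (Config Λ n) (Config Λ n) ℂ :=
  fun α β => hoppingMatrix G t α.1 β.1

/-- Lieb's matrix `L_x`: the diagonal occupation matrix `(L_x)_{αβ} = ⟨ψ^β| n_x |ψ^α⟩` of the
site `x` on `n`-particle configurations. Lieb, PRL 62 (1989) 1201, eq. (3). [cite: LiebPRL1989, eq. (3)] -/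
def liebL (n : ℕ) (x : Λ) : Matrix (Config Λ n) (Config Λ n) ℂ :=
  diagonal fun α => if x ∈ α.1 then 1 else 0

/-- The spinless hopping term `c†_x c_y` restricted to `n`-particle configurations.
Lieb, PRL 62 (1989) 1201, eq. (3). [cite: LiebPRL1989, eq. (3)] -/
def configHop (n : ℕ) (x y : Λ) : Matrix (Config Λ n) (Config Λ n) ℂ :=
  fun α α' => (creation x * annihilation y : Matrix (Finset Λ) (Finset Λ) ℂ) α.1 α'.1

variable {G}

/-- Entries of the hopping matrix. [folklore] -/
theorem hoppingMatrix_apply (t : ℝ) (s u : Finset Λ) :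
    hoppingMatrix G t s u =
      -(t : ℂ) * ∑ x : Λ, ∑ y : Λ,
        if G.Adj x y then (creation x * annihilation y) s u else 0 := by
  simp only [hoppingMatrix, Matrix.smul_apply, Matrix.sum_apply, smul_eq_mul]
  congr 1
  refine Finset.sum_congr rfl fun x _ => Finset.sum_congr rfl fun y _ => ?_
  split_ifs <;> rfl

/-- The hopping matrix is Hermitian (the sum over ordered pairs contains every term together
with its adjoint). Lieb, PRL 62 (1989) 1201 (`T` Hermitian). [cite: LiebPRL1989, Remark (1)] -/
theorem hoppingMatrix_conjTranspose (t : ℝ) : (hoppingMatrix G t)ᴴ = hoppingMatrix G t := by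
  simp only [hoppingMatrix, conjTranspose_smul, conjTranspose_sum, Complex.star_def, map_neg,
    Complex.conj_ofReal]
  congr 1
  rw [Finset.sum_comm]
  refine Finset.sum_congr rfl fun x _ => Finset.sum_congr rfl fun y _ => ?_
  by_cases h : G.Adj x y
  · rw [if_pos h, if_pos h.symm, conjTranspose_mul, creation, conjTranspose_conjTranspose]
    rfl
  · rw [if_neg h, if_neg (fun h' => h h'.symm), conjTranspose_zero]

/-- `K` in terms of the restricted hopping terms. [folklore] -/
theorem liebK_eq_sum (t : ℝ) (n : ℕ) :
    liebK G t n = -(t : ℂ) • ∑ x : Λ, ∑ y : Λ, if G.Adj x y then configHop n x y else 0 := by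
  ext α β
  rw [liebK, hoppingMatrix_apply, Matrix.smul_apply, Matrix.sum_apply, smul_eq_mul]
  congr 1
  refine Finset.sum_congr rfl fun x _ => ?_
  rw [Matrix.sum_apply]
  refine Finset.sum_congr rfl fun y _ => ?_
  split_ifs <;> rfl

omit [Fintype Λ] [DecidableRel G.Adj] in
/-- `L_x` is Hermitian (real diagonal). Lieb, PRL 62 (1989) 1201 ("`L_x` ... real and symmetric"). [cite: LiebPRL1989, eq. (3)] -/
theorem liebL_conjTranspose (n : ℕ) (x : Λ) :
    (liebL n x : Matrix (Config Λ n) _ ℂ)ᴴ = liebL n x := by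
  rw [liebL, diagonal_conjTranspose]
  congr 1
  funext α
  by_cases h : x ∈ α.1 <;> simp [h]

omit [DecidableRel G.Adj] in
/-- `L_x` acts as the indicator of `x ∈ α`. Lieb, PRL 62 (1989) 1201, eq. (3). [cite: LiebPRL1989, eq. (3)] -/
theorem liebL_mulVec_apply (n : ℕ) (x : Λ) (v : Config Λ n → ℂ) (α : Config Λ n) :
    (liebL n x *ᵥ v) α = if x ∈ α.1 then v α else 0 := by
  rw [liebL, mulVec_diagonal]
  split_ifs <;> simp

end LiebMatrices

/-! ### Lieb's coefficient matrix `W` -/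

section CoefficientMatrix

variable {Λ : Type*} [LinearOrder Λ] [Fintype Λ]

/-- Lieb's coefficient matrix of a Fock vector in the `(n, n)` sector:
`W_{αβ} = σ(α, β) ψ(α↑ ∪ β↓)`, i.e. `ψ = Σ W_{αβ} ψ^α_↑ ⊗ ψ^β_↓` ("this `W_{αβ}` is here
viewed as an `m × m` matrix"). Lieb, PRL 62 (1989) 1201, proof of Theorem 1. [cite: LiebPRL1989, proof of Theorem 1] -/
def liebW (n : ℕ) (ψ : Fock (Orb Λ)) : Matrix (Config Λ n) (Config Λ n) ℂ :=
  fun α β => pairSign α.1 β.1 * ψ (pairSet α.1 β.1)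

/-- The Fock vector `Σ W_{αβ} ψ^α_↑ ⊗ ψ^β_↓` with coefficient matrix `W` (inverse of `liebW`
on the `(n, n)` sector). Lieb, PRL 62 (1989) 1201, proof of Theorem 1. [cite: LiebPRL1989, proof of Theorem 1] -/
def liebVec (n : ℕ) (W : Matrix (Config Λ n) (Config Λ n) ℂ) : Fock (Orb Λ) :=
  fun s => if h : (upPart s).card = n ∧ (downPart s).card = n then
    pairSign (upPart s) (downPart s) * W ⟨upPart s, h.1⟩ ⟨downPart s, h.2⟩ else 0

/-- Unfolding lemma for `liebW`. [folklore] -/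
theorem liebW_apply (n : ℕ) (ψ : Fock (Orb Λ)) (α β : Config Λ n) :
    liebW n ψ α β = pairSign α.1 β.1 * ψ (pairSet α.1 β.1) := rfl

/-- `liebW` is additive. [folklore] -/
theorem liebW_add (n : ℕ) (ψ φ : Fock (Orb Λ)) : liebW n (ψ + φ) = liebW n ψ + liebW n φ := by
  ext α β; simp [liebW_apply, mul_add]

/-- `liebW` is homogeneous. [folklore] -/
theorem liebW_smul (n : ℕ) (c : ℂ) (ψ : Fock (Orb Λ)) : liebW n (c • ψ) = c • liebW n ψ := by
  ext α β; simp [liebW_apply, mul_left_comm]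

/-- `liebW 0 = 0`. [folklore] -/
theorem liebW_zero (n : ℕ) : liebW n (0 : Fock (Orb Λ)) = 0 := by
  ext α β; simp [liebW_apply]

/-- `liebW` respects subtraction. [folklore] -/
theorem liebW_sub (n : ℕ) (ψ φ : Fock (Orb Λ)) : liebW n (ψ - φ) = liebW n ψ - liebW n φ := by
  ext α β; simp [liebW_apply, mul_sub]

/-- `liebW n` as a linear map. Lieb, PRL 62 (1989) 1201, proof of Theorem 1 ("by linearity"). [cite: LiebPRL1989, proof of Theorem 1] -/
def liebWLin (n : ℕ) : Fock (Orb Λ) →ₗ[ℂ] Matrix (Config Λ n) (Config Λ n) ℂ where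
  toFun := liebW n
  map_add' := liebW_add n
  map_smul' := liebW_smul n

/-- Unfolding lemma for `liebWLin`. [folklore] -/
@[simp] theorem liebWLin_apply (n : ℕ) (ψ : Fock (Orb Λ)) : liebWLin n ψ = liebW n ψ := rfl

/-- `liebW` commutes with finite sums. [folklore] -/
theorem liebW_sum {ι : Type*} (n : ℕ) (S : Finset ι) (f : ι → Fock (Orb Λ)) :
    liebW n (∑ i ∈ S, f i) = ∑ i ∈ S, liebW n (f i) := by
  rw [← liebWLin_apply, map_sum]
  rfl

/-- `liebVec n W` lies in the `(n, n)` sector. [folklore] -/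
theorem isInSector_liebVec (n : ℕ) (W : Matrix (Config Λ n) (Config Λ n) ℂ) :
    IsInSector n n (liebVec n W) :=
  fun _ hs => dif_neg hs

omit [LinearOrder Λ] in
/-- Sums over `n`-element subsets as sums over all subsets (for summands vanishing off
cardinality `n`). [folklore] -/
theorem sum_config_eq_sum {M : Type*} [AddCommMonoid M] (n : ℕ) (f : Finset Λ → M)
    (hf : ∀ γ, γ.card ≠ n → f γ = 0) : ∑ γ : Config Λ n, f γ.1 = ∑ γ : Finset Λ, f γ := by
  rw [← Finset.sum_subtype (univ.filter fun γ : Finset Λ => γ.card = n) (by simp),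
    Finset.sum_filter_of_ne]
  exact fun γ _ h => by_contra fun h' => h (hf γ h')

end CoefficientMatrix

end Literature.MathematicalPhysics.QuantumLattice
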